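import Summits.Langlands.Langlands.Theses.QuadraticWindow
import Literature.NumberTheory.Automorphic.AsaiSign
import Literature.NumberTheory.Automorphic.WeaklyRegularGaloisRep
import Literature.NumberTheory.Automorphic.BaseChangeInductionAlong
import Literature.NumberTheory.GaloisRepresentations.SorensenPatching
import Literature.NumberTheory.GaloisRepresentations.WeilLAdicCharacterProofs
import Literature.NumberTheory.GaloisRepresentations.InducedGaloisRep

/-!
# Line `one-transparent-pane` — checked skeleton for the crux
`Summit.Langlands.Langlands.Theses.QuadraticWindow.HostInducedRep` (stmt-Langlands-10902)

Planner crux-plan, round 1 (idea `Ideas/one-transparent-pane.md`, merged with `flicker-period-sign-pin`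
by all three triagers).  Seven registered stubs `stub_*` (sorried; each a genuine lemma of the line) and
the kernel-checked composition `HostInducedRep_of : HostInducedRep` (no `sorry` outside the stubs).
Line card: `Lines/one-transparent-pane.md`.

## The line in one paragraph (ARCH-B, "the biquadratic pane")

Crux data: `F/F₀` quadratic (involution `τ`), `π` cuspidal regular algebraic on `GL_n/F`, `τ`-polarized
w.r.t. the Artin avatar `e` and `k`, parity-normalised on the split real places (`hpar`), an admissible
finite-order twist `eψ`; wanted: the induced package `R : Γ_{F₀} → GL_{2n}(ℚ̄_ℓ)` with the induced
Frobenius polynomial at EVERY good place.  Engine (for `F` NOT totally real; the totally real stratum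
is the known case, `stub_totallyRealInduction`): `π' := π ⊗ ψ` (`ψ` the Hecke character with avatar
`eψ`), `Π := AI_{F/F₀}(π')`, a CM quadratic `K/F₀` (from an `S`-general family), `L := F·K` with its
THIRD quadratic subfield `F' = L^{s}` (`s = τ̃·c̃`), and a Hecke character `ψ₀` of `K` with
`ψ₀ ψ₀^c = θ ∘ N_{K/F₀}` (`θ` the inverse polarization character of `π'`) chosen of UNITARY type —
always exists, no parity obstruction — and then normalised.  The representation
`P := BC_{L/F}(π') ⊗ (ψ₀ ∘ N_{L/K})` of `GL_n(𝔸_L)` is HONESTLY conjugate self-dual w.r.t. `L/F'`,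
and `τ' := Π_K ⊗ ψ₀ = AI_{L/K}(P)` is conjugate self-dual w.r.t. `K/F₀`.  The `s`-fixed complex
places of `L` are exactly the places over the complex-type real places of `F₀` (where `F` is
complex): there `P` has the MULTIPLICITY-FREE exponents `p_i + a_u` — the ONE TRANSPARENT PANE —
while `τ'` has every exponent doubled.  The sign pin (`stub_signPin`: a conjugate self-dual cuspidal
representation with Asai sign `κ` has, at a `c`-fixed complex place with multiplicity-free exponents
in one real coset, that coset equal to `(N-1)/2 + (1-κ)/4`) read through the pane, plus the Asai
factorisation of an automorphic induction in a biquadratic tower (`stub_asaiPoleInduced`), gives the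
PANE LAW (`stub_paneLaw`): if the pane shows exponents in `½ + ℤ` then `τ'` has the STANDARD Asai
sign.  Normalising `ψ₀` so that `τ'` is `C`-algebraic for `GL_{2n}` (type I, exponents in `½ + ℤ`;
possible at every real place of `F₀` at once exactly by `hpar` and the `e ↔ e·ω_{F/F₀}` freedom —
`stub_package`) therefore makes `τ'` weakly regular, `C`-algebraic, conjugate self-dual AND odd, i.e.
an input of Fakhruddin–Pilloni Thm. 9.10 (tree fact `FakhruddinPilloni2021_galoisRep_of_weaklyRegular_odd`;
`stub_galoisOverK` = strong multiplicity one + that fact + Weil's `ℓ`-adic avatar of the algebraic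
`ψ₁ = ψ₀‖·‖^{-n/2}` + twist + continuous semisimplification), which controls EVERY unramified place
`u ∤ ℓ` of `K` (no `Ram(G)` restriction: Disproof §6 is answered), and Sorensen patching over the
family (`stub_patch`, tree theorem `SorensenPatching.exists_framedGaloisRep`) descends the `r'_K` to
the wanted `R` over `F₀`, read off at every good `v` through a member in which `v` splits.

## Disproof used (Cruxes/HostInducedRep/Disproof.lean, gen-4 of 2026-08-16T00:58Z; gen-3 read at start)
No `_false_without_` theorem, no `-- Targets` kill and no landed `Negative/` lemma exist for this crux
(re-checked at the publish boundary); gen-4 §9 (`HostInducedRep` = `TwistedStrongReciprocityAt` for the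
twists `π ⊗ ψ` + `HasQuadraticInduction`, `hostInducedRep_of_reciprocity_of_induction`) is EXACTLY the
shape of `stub_totallyRealInduction` (lang.S27 supplies `TwistedStrongReciprocityAt` for `F` totally real)
and of the pair `stub_galoisOverK`/`stub_patch` (which supply it for `F` with a complex place through the
CM family instead of through `ρ_π`); §11 (`hasQuadraticInduction_one`) and §12 (`hostInducedRepAt_one`,
PROVED) make rank one a theorem — the lead may import it, the skeleton does not need it;
§6 (control set) is MET, not weakened: FP 9.10 controls all unramified `u ∤ ℓ`, and the coverage
clause of `stub_package` needs control at ONE place above a good `v` only (so a polarization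
character ramified at a good `v` costs nothing); §7/§8bis: `hodd`, `hunr`, `hℓ` are passed through
unused, `hpar` is consumed by `stub_package`, the sign law (risk (a)) is `stub_signPin` +
`stub_asaiPoleInduced` + `stub_paneLaw`, and the analysis showed the engine genuinely FAILS without a
complex place of `F` (weight-one induced forms, `n = 1`), whence the separate known stratum
`stub_totallyRealInduction`; §1 (`0 < n` forced by `hψnti`) is used inside `stub_package`; §3b/§4
(shapes `P_w(X²)`, `P_w·P_{τw}`) are what the Satake clauses and `stub_patch` reproduce; §5 (Satake
uniqueness consumed) is harmless (`hasSatakeParamAt_unique_holds`).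
-/

open Literature.NumberTheory.Automorphic Literature.NumberTheory.GaloisRepresentations
open IsDedekindDomain NumberField Filter

set_option linter.dupNamespace false

namespace Summit.Langlands.Langlands.Cruxes.HostInducedRep.OneTransparentPane

/-! ## Stub 1 — the lever: the Asai sign pins the parity at a `c`-fixed complex place -/

/-- **Stub 1 (`stub_signPin`, THE LEVER; hardest).**  `E/F` quadratic with involution `c`, `P` a
cuspidal automorphic representation of `GL_N(𝔸_E)`, `N ≥ 1`, conjugate self-dual (a.e. on Satake
parameters) with Asai sign `κ` (`HasAsaiSign c κ`: `L^S(s, P, As^{(-1)^{N-1}κ})` has the pole at `s = 1`),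
and `σ : E → ℂ` a complex place FIXED by `c` (`IsConj σ c`: `c` acts as complex conjugation in `E_σ = ℂ`,
i.e. `σ` lies over a real place of `F`).  If the archimedean exponents `χ σ = {a_i}` of `P` at `σ`
(`HasArchParameter`) are multiplicity-free and lie in ONE real coset `r + ℤ`, then that coset is
`(N-1)/2 + (1-κ)/4 + ℤ` (`κ = 1`: `(N-1)/2 + ℤ`; `κ = -1`: `N/2 + ℤ`).
Why true: single real coset + Nodup exclude complementary series, so `P_σ = ⊞ z^{a_i} z̄^{-a_i}` is
tempered with every character SELF-conjugate-dual and of multiplicity one; the conjugate-dual form of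
sign `(-1)^{N-1}κ` carried by the parameter of `P_σ` (Mok: `P` is the `ξ_{χ_κ}`-base change from the
quasi-split `U_{E/F}(N)`, local–global compatible at `∞`; or without the endoscopic classification:
Asai pole ⇒ `(GL_N(𝔸_F), μ∘det)`-period (Flicker 1988, Flicker–Zinoviev, Kable 2004) ⇒ local
distinction ⇒ Kemarsky 2015 Thm 1.3 / Pattanayak–Wu–Zhang arXiv:2501.14449 Thm 1.1(2), 3.3) must then
be an orthogonal sum of rank-one forms, each of sign `(-1)^{2a_i}`; hence `(-1)^{2a_i} = (-1)^{N-1}κ`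
for every `i`.  Calibrations: `N = 1` (`κ = 1 ⇔ χ|_{𝔸_F} = 1 ⇔ a ∈ ℤ`), `N = 2` base change of a
Hilbert form (triage r1-2 §A).
[cite: Mok2014, Thm 2.5.4(a), Cor 2.5.5] [cite: Flicker1988] [arXiv:2501.14449, Thm 1.1(2)/3.3] -/
theorem stub_signPin :
    ∀ (F E : Type) [Field F] [NumberField F] [Field E] [NumberField E] [Algebra F E]
      (c : E ≃ₐ[F] E), Module.finrank F E = 2 → c ≠ 1 →
    ∀ (N : ℕ) (hcpt : isCompact_glFiniteIntegralLevel N E) (P : CuspidalAutomorphicRepData N E hcpt)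
      (κ : ℤˣ) (χ : (E →+* ℂ) → Multiset ℂ) (σ : E →+* ℂ) (r : ℝ),
      0 < N → P.1.IsConjSelfDualAE c → P.1.HasAsaiSign c κ → P.1.HasArchParameter χ →
      NumberField.ComplexEmbedding.IsConj σ c → (χ σ).Nodup →
      (∀ a ∈ χ σ, ∃ m : ℤ, a = (m : ℂ) + (r : ℂ)) →
      ∀ a ∈ χ σ, ∃ m : ℤ, a = (m : ℂ) + ((N : ℂ) - 1) / 2 + (1 - ((κ : ℤ) : ℂ)) / 4 := by
  sorry

/-! ## Stub 2 — Asai poles of an automorphic induction in a biquadratic tower -/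

/-- **Stub 2 (`stub_asaiPoleInduced`).**  Tower: `K/F₀` quadratic with involution `cK`, `L/K` quadratic,
and a second quadratic subextension `L/F'` with involution `s` restricting to `cK` on `K` (so `L/F₀` is
biquadratic with subfields `K`, `F' = L^s` and `F := L^{s·t}`, `t` generating `Gal(L/K)`).  If `Q` on
`GL_{2n}(𝔸_K)` is CUSPIDAL and a (weak) automorphic induction of the cuspidal `P` on `GL_n(𝔸_L)`, and
`P` is conjugate self-dual w.r.t. `s`, then for both signs `ε` the partial Asai `L`-function
`L^S(s, Q, As^ε_{K/F₀})` has the pole at `s = 1` iff `L^S(s, P, As^ε_{L/F'})` does.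
Why true: `As^ε_{K/F₀}(Ind_{L/K} ρ) ≅ Ind_{F'/F₀} As^ε_{L/F'}(ρ) ⊕ Ind_{F/F₀} As^ε_{L/F}(ρ)` — CHECKED on
characters coset by coset of `Gal(L/F₀) = {1, t, c̃, s}` (on `Γ_L`: `(ρ+ρ^t)(ρ^s+ρ^{c̃})`; on `tΓ_L`:
`0`; on `c̃Γ_L`: `ρ((c̃m)²)+ρ^t((c̃m)²)`; on `sΓ_L`: `ρ((sm)²)+ρ^t((sm)²)`), both `ε` (twist by
`ω_{K/F₀}` ↔ `ω_{L/F'}`, `ω_{L/F}`); so on partial `L`-functions of the induced Satake data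
(`IsAutomorphicInductionAlong`, `inducedSatakePolynomial`)
`L^S(Q, As^ε) = L^{S'}(P, As^ε_{L/F'}) · L^{S''}(P, As^ε_{L/F})`; the second factor is holomorphic and
NON-ZERO at `s = 1` (Shahidi 1981 Thm 5.1 / Jacquet–Shalika on `Re s = 1`; a pole would make `P`
also `L/F`-conjugate self-dual, hence `P ≅ P^t` a.e., contradicting cuspidality of `Q = AI(P)`,
Arthur–Clozel Ch. 3 Thm 4.2/6.2 with Jacquet–Shalika); finitely many Euler factors are finite and
non-zero at `1` (`|α| < q^{1/2}`); conjugate self-dual cuspidal data are unitary.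
[cite: Flicker1988, Theorem p.297] [cite: ShahidiAJM1981, Thm 5.1] [cite: Mok2014, §2.5]
[cite: ArthurClozelAMS120, Ch.3 Thm 4.2, 6.2] [cite: JacquetShalikaAJM1981] -/
theorem stub_asaiPoleInduced :
    ∀ (F₀ K F' L : Type) [Field F₀] [NumberField F₀] [Field K] [NumberField K]
      [Field F'] [NumberField F'] [Field L] [NumberField L]
      [Algebra F₀ K] [Algebra K L] [Algebra F' L] (cK : K ≃ₐ[F₀] K) (s : L ≃ₐ[F'] L),
      Module.finrank F₀ K = 2 → Module.finrank K L = 2 → Module.finrank F' L = 2 → cK ≠ 1 → s ≠ 1 →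
      (∀ x : K, s (algebraMap K L x) = algebraMap K L (cK x)) →
    ∀ (n : ℕ) (hL : isCompact_glFiniteIntegralLevel n L)
      (hK : isCompact_glFiniteIntegralLevel (2 * n) K)
      (P : CuspidalAutomorphicRepData n L hL) (Q : CuspidalAutomorphicRepData (2 * n) K hK),
      0 < n → IsAutomorphicInductionAlong P.1 Q.1 → P.1.IsConjSelfDualAE s → Q.1.IsConjSelfDualAE cK →
      ∀ ε : ℤˣ, Q.1.HasAsaiPole cK ε ↔ P.1.HasAsaiPole s ε := by
  sorry

/-! ## Stub 3 — the pane law: `½ + ℤ` at the pane ⇒ standard sign of the induced representation -/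


/-- **Stub 3 (`stub_paneLaw`).**  GIVEN the sign pin (statement of `stub_signPin`) and the Asai pole
transfer (statement of `stub_asaiPoleInduced`), the PANE LAW holds: in the tower of Stub 2, if `P` (cuspidal on `GL_n/L`,
`s`-conjugate self-dual, `Q = AI_{L/K}(P)` cuspidal and `cK`-conjugate self-dual) shows at an `s`-fixed
complex place `σ` of `L` a multiplicity-free set of `n` exponents all in `½ + ℤ`, then `Q` has the
STANDARD Asai sign (`HasAsaiSign cK 1`: `L^S(s, Q, As⁻)` has the pole — `Q` is odd in
Fakhruddin–Pilloni's sense, i.e. descends to the quasi-split `U_{K/F₀}(2n)` through `ξ₊`).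
Why true: by Mok's dichotomy (`Mok2014_partialAsaiL_pole_dichotomy`, `exists_hasAsaiSign`,
`existsUnique_hasAsaiSign`; an Asai datum exists by Flath + finiteness of ramification) `P` has a sign
`κ_P`; the pin with `r = ½` gives `½ ≡ (n-1)/2 + (1-κ_P)/4 (mod ℤ)`, i.e. `κ_P = (-1)^n` in either
parity of `n`; `hasAsaiPole_iff_hasAsaiSign`: `HasAsaiSign s ((-1)^n) = HasAsaiPole s (-1)`, the
transfer gives `HasAsaiPole cK (-1)` for `Q`, which for `N = 2n` even is `HasAsaiSign cK 1`
(`hasAsaiSign_iff_of_even`).  [cite: Mok2014, Thm 2.5.4(a)] -/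
theorem stub_paneLaw
    (hpin : ∀ (F E : Type) [Field F] [NumberField F] [Field E] [NumberField E] [Algebra F E]
      (c : E ≃ₐ[F] E), Module.finrank F E = 2 → c ≠ 1 →
    ∀ (N : ℕ) (hcpt : isCompact_glFiniteIntegralLevel N E) (P : CuspidalAutomorphicRepData N E hcpt)
      (κ : ℤˣ) (χ : (E →+* ℂ) → Multiset ℂ) (σ : E →+* ℂ) (r : ℝ),
      0 < N → P.1.IsConjSelfDualAE c → P.1.HasAsaiSign c κ → P.1.HasArchParameter χ →
      NumberField.ComplexEmbedding.IsConj σ c → (χ σ).Nodup →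
      (∀ a ∈ χ σ, ∃ m : ℤ, a = (m : ℂ) + (r : ℂ)) →
      ∀ a ∈ χ σ, ∃ m : ℤ, a = (m : ℂ) + ((N : ℂ) - 1) / 2 + (1 - ((κ : ℤ) : ℂ)) / 4)
    (htransfer : ∀ (F₀ K F' L : Type) [Field F₀] [NumberField F₀] [Field K] [NumberField K]
      [Field F'] [NumberField F'] [Field L] [NumberField L]
      [Algebra F₀ K] [Algebra K L] [Algebra F' L] (cK : K ≃ₐ[F₀] K) (s : L ≃ₐ[F'] L),
      Module.finrank F₀ K = 2 → Module.finrank K L = 2 → Module.finrank F' L = 2 → cK ≠ 1 → s ≠ 1 →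
      (∀ x : K, s (algebraMap K L x) = algebraMap K L (cK x)) →
    ∀ (n : ℕ) (hL : isCompact_glFiniteIntegralLevel n L)
      (hK : isCompact_glFiniteIntegralLevel (2 * n) K)
      (P : CuspidalAutomorphicRepData n L hL) (Q : CuspidalAutomorphicRepData (2 * n) K hK),
      0 < n → IsAutomorphicInductionAlong P.1 Q.1 → P.1.IsConjSelfDualAE s → Q.1.IsConjSelfDualAE cK →
      ∀ ε : ℤˣ, Q.1.HasAsaiPole cK ε ↔ P.1.HasAsaiPole s ε) :
    ∀ (F₀ K F' L : Type) [Field F₀] [NumberField F₀] [Field K] [NumberField K]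
      [Field F'] [NumberField F'] [Field L] [NumberField L]
      [Algebra F₀ K] [Algebra K L] [Algebra F' L] (cK : K ≃ₐ[F₀] K) (s : L ≃ₐ[F'] L),
      Module.finrank F₀ K = 2 → Module.finrank K L = 2 → Module.finrank F' L = 2 → cK ≠ 1 → s ≠ 1 →
      (∀ x : K, s (algebraMap K L x) = algebraMap K L (cK x)) →
    ∀ (n : ℕ) (hL : isCompact_glFiniteIntegralLevel n L)
      (hK : isCompact_glFiniteIntegralLevel (2 * n) K)
      (P : CuspidalAutomorphicRepData n L hL) (Q : CuspidalAutomorphicRepData (2 * n) K hK)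
      (χ : (L →+* ℂ) → Multiset ℂ) (σ : L →+* ℂ),
      0 < n → IsAutomorphicInductionAlong P.1 Q.1 → P.1.IsConjSelfDualAE s → Q.1.IsConjSelfDualAE cK →
      P.1.HasArchParameter χ → NumberField.ComplexEmbedding.IsConj σ s → (χ σ).Nodup →
      Multiset.card (χ σ) = n → (∀ a ∈ χ σ, ∃ m : ℤ, a = (m : ℂ) + 1 / 2) →
      Q.1.HasAsaiSign cK 1 := by
  sorry

/-! ## Stub 4 — the automorphic package (type-I, standard-sign, CM family), GIVEN the pane law -/

/-- **Stub 4 (`stub_package`, the laundering; longest).**  GIVEN the pane law (hypothesis `hpane` = the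
conclusion of `stub_paneLaw`, verbatim; once `stub_paneLaw` has landed the lead should re-register this
stub WITHOUT `hpane` — the ledger cuts registered signatures at 3900 characters, this file is
authoritative), for crux data `(F₀, F, τ, n, π, e, k, ℓ, ι, eψ)` with the crux's hypotheses (minus the
four the engine never uses: `hodd`, `ℓ ∤ disc F`, `π`/`eψ` unramified above `ℓ` — Disproof §7) AND `F`
NOT totally real (so at least one real place of `F₀` is complex in `F`: a pane exists), there is a
family, indexed by some type `J`, of CM quadratic extensions `K_j/F₀` carrying: a cuspidal `τ'_j` on
`GL_{2n}(𝔸_{K_j})` with an infinity type `T_j` that is `C`-algebraic and weakly regular (type I),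
conjugate self-dual a.e. and of STANDARD Asai sign (odd), an ALGEBRAIC Hecke character `ψ₁ʲ` of `K_j`,
a finite exceptional set `E_j` of places of `F₀`, and a finite `S₀`, such that: (generality) for
`v ∉ S₀` infinitely many distinct `Γ_{K_j} ≤ Γ_{F₀}` have `v` split in `K_j` and `v ∉ E_j`; (control)
for `v ∤ ℓ`, `v ∉ E_j`, good (carrying a guard family `(α, c)`) and split in `K_j`, at EVERY `u ∣ v`:
`u ∤ ℓ`, `ψ₁ʲ` is unramified at `u`, and `τ'_j` has a Satake parameter `β` at `u` whose
`ψ₁ʲ(ϖ_u)⁻¹`-twist has arithmetic-Frobenius polynomial (rank `2n`, `C`-normalisation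
`arithFrobPolyOfSatake`) EQUAL to the crux's host polynomial `∏_{w∣v} P_w(X^{f(w∣v)})` at `v`;
(coverage) every good `v ∤ ℓ` splits in SOME member with the same control at ONE place `u ∣ v`
(enough for reading off a Frobenius class; this is where a good `v` at which the polarization character
ramifies is served, by a member whose `ψ₀` is unramified at `u` and ramified at `ū`).
Intended construction: `ψ` := the finite-order Hecke character of `F` with Artin avatar `eψ`
(`ψ(ϖ_w) = c_w`; class-field dictionary `HeckeCharacterGaloisAvatar`), `π' := π ⊗ ψ`,
`Π := AI_{F/F₀}(π')` (cuspidal by `hψnti`; Arthur–Clozel Ch. 3 Thm 6.2 with the LOCAL identities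
(6.1)/(6.2) at every place unramified for `F/F₀` and `π'`), `K_j := F₀(√-d_j)` (`d_j ≫ 0`, CM since
`F₀` is totally real) avoiding the finitely many `K` with `Π ≅ Π ⊗ ω_K` (so `Π_{K_j} := BC(Π)` is
cuspidal, Arthur–Clozel Thm 4.2), `θ := η'⁻¹` for the polarization character `η' = η·ψ|_{𝔸_{F₀}}` of
`π'` read off `hpol` a.e. — with the freedom `e ↔ e·ω_{F/F₀}` (both polarise `π`; `hpol`, `hpar` are
blind to the switch), `ψ₀ʲ := ψ_un ‖·‖_K^{k/2}` with `ψ_un` a unitary extension to `𝔸_K^×/K^×` of the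
finite-order character `χ'⁻¹ξ` of the closed subgroup `𝔸_{F₀}^×/F₀^×` (`ξ ∈ {1, ω_K}`; Pontryagin), so
`ψ₀ψ₀^c = θ∘N`, `τ'_j := Π_{K_j} ⊗ ψ₀ʲ`, `ψ₁ʲ := ψ₀ʲ‖·‖^{-n/2}`, and the pane data
`P_j := BC_{L_j/F}(π') ⊗ ψ₀ʲ∘N_{L_j/K_j}` (`L_j = F K_j`, `s = τ̃ c̃` fixes both complex places of `L_j`
over a complex-type `v`; exponents `{p_i + a_u}`, `a_u = (m_u + k)/2`, `(-1)^{m_u} = d_v ξ_∞`,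
`d_v = det e(c_v)`).  Type I at `u` ⇔ `m_u + k ≡ n (2)` ⇔ `d_v ξ_∞ = (-1)^{n+k}`; the pin at a pane gives
`(-1)^{m_u+k} = κ_{P_j}` — so `d_v = κ_{P_j} (-1)^k ξ_∞` is CONSTANT on the complex-type places — and
type I there ⇔ `κ_{P_j} = (-1)^n`, arranged by the choice of `ξ` and then equivalent (pane law) to the
standard sign of `τ'_j`; on the split-type places type I ⇔ `d_split = d_cx`: `hpar` makes `d_split`
constant and the `e ↔ e·ω` switch matches it (it flips `d_cx` only).  Then `ψ₁ʲ` is algebraic (integral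
type), `T_j` = the doubled type `{p_i + a_u} + {q_i + a_u}` is weakly regular (`π'` regular, Clozel
purity `p_i + q_i = -k`) and `C`-algebraic; BLGGT Lemma A.2.5 / weak approximation controls the
ramification of `ψ_un` above finitely many prescribed places (index the family by field and target
place).  Satake clause: `Sat(τ'_j,u) = Sat(Π,v)·ψ₀(ϖ_u)`, `Sat(Π,v)` = `f(w|v)`-th roots of `α_w c_w`
(`inducedSatakePolynomial`), and `(√q_v)^{2n-1} · q_v^{-n/2} = (√q_v)^{n-1}` converts the rank-`2n`
normalisation at `q_u = q_v` into the rank-`n` one at `q_w = q_v^{f}` (Disproof §3b/§4 shapes).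
[cite: ArthurClozelAMS120, Ch.3 Thm 4.2, 6.2, (6.1)-(6.2)] [cite: Clozel1990, §3.3, Lemme 3.14, 4.9]
[arXiv:1010.2561, Lemma A.2.5] [cite: Mok2014, §2.2] [cite: JacquetShalikaAJM1981] -/
theorem stub_package
    (hpane : ∀ (F₀ K F' L : Type) [Field F₀] [NumberField F₀] [Field K] [NumberField K]
      [Field F'] [NumberField F'] [Field L] [NumberField L]
      [Algebra F₀ K] [Algebra K L] [Algebra F' L] (cK : K ≃ₐ[F₀] K) (s : L ≃ₐ[F'] L),
      Module.finrank F₀ K = 2 → Module.finrank K L = 2 → Module.finrank F' L = 2 → cK ≠ 1 → s ≠ 1 →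
      (∀ x : K, s (algebraMap K L x) = algebraMap K L (cK x)) →
    ∀ (n : ℕ) (hL : isCompact_glFiniteIntegralLevel n L)
      (hK : isCompact_glFiniteIntegralLevel (2 * n) K)
      (P : CuspidalAutomorphicRepData n L hL) (Q : CuspidalAutomorphicRepData (2 * n) K hK)
      (χ : (L →+* ℂ) → Multiset ℂ) (σ : L →+* ℂ),
      0 < n → IsAutomorphicInductionAlong P.1 Q.1 → P.1.IsConjSelfDualAE s → Q.1.IsConjSelfDualAE cK →
      P.1.HasArchParameter χ → NumberField.ComplexEmbedding.IsConj σ s → (χ σ).Nodup →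
      Multiset.card (χ σ) = n → (∀ a ∈ χ σ, ∃ m : ℤ, a = (m : ℂ) + 1 / 2) →
      Q.1.HasAsaiSign cK 1) :
    ∀ (F₀ F : Type) [Field F₀] [NumberField F₀] [Field F] [NumberField F] [Algebra F₀ F] (τ : F ≃ₐ[F₀] F),
      NumberField.IsTotallyReal F₀ → Module.finrank F₀ F = 2 → τ ≠ 1 →
    ∀ (n : ℕ) (hcpt : isCompact_glFiniteIntegralLevel n F) (π : CuspidalAutomorphicRepData n F hcpt)
      (e : FramedGaloisRep F₀ ℂ 1) (k : ℤ), π.1.IsRegularAlgebraic →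
      (∀ᶠ w in Filter.cofinite, ∀ (α β : Multiset ℂ) (c : ℂ), π.1.HasSatakeParamAt w α →
        π.1.HasSatakeParamAt (τ • w) β → e.HasFrobCharpolyAt (w.under (𝓞 F₀)) (Polynomial.X - Polynomial.C c) →
        β = α.map (fun a ↦ a⁻¹ * (c * ((w.under (𝓞 F₀)).residueCard : ℂ) ^ k) ^ w.asIdeal.inertiaDeg (𝓞 F₀))) →
      ((e.restrictField F).IsOdd ∨ ∀ (φ : F →+* ℝ) (c : Field.absoluteGaloisGroup F),
        IsComplexConjugation φ c → Matrix.GeneralLinearGroup.det ((e.restrictField F) c) = 1) →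
    ∀ (ℓ : ℕ) [Fact ℓ.Prime] (ι : PadicAlgCl ℓ ≃+* ℂ) (eψ : FramedGaloisRep F ℂ 1),
      (∀ (φ : F →+* ℝ) (c c' : Field.absoluteGaloisGroup F), IsComplexConjugation φ c →
        IsComplexConjugation (φ.comp (τ : F →+* F)) c' →
        Matrix.GeneralLinearGroup.det (eψ c) = Matrix.GeneralLinearGroup.det (eψ c')) →
      (∃ᶠ w in Filter.cofinite, ∃ (α β : Multiset ℂ) (c c' : ℂ), π.1.HasSatakeParamAt w α ∧
        π.1.HasSatakeParamAt (τ • w) β ∧ eψ.HasFrobCharpolyAt w (Polynomial.X - Polynomial.C c) ∧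
        eψ.HasFrobCharpolyAt (τ • w) (Polynomial.X - Polynomial.C c') ∧ β.map (fun b ↦ b * c') ≠ α.map (fun a ↦ a * c)) →
    ¬ NumberField.IsTotallyReal F →
    ∃ (J : Type) (K : J → Type) (_ : ∀ j, Field (K j)) (_ : ∀ j, NumberField (K j))
      (_ : ∀ j, IsCMField (K j)) (_ : ∀ j, Algebra F₀ (K j))
      (hK : ∀ j, isCompact_glFiniteIntegralLevel (2 * n) (K j))
      (τ' : ∀ j, CuspidalAutomorphicRepData (2 * n) (K j) (hK j)) (T : ∀ j, InfinityType (K j) (2 * n))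
      (ψ₁ : ∀ j, HeckeCharacter (K j)) (E : J → Set (HeightOneSpectrum (𝓞 F₀)))
      (S₀ : Set (HeightOneSpectrum (𝓞 F₀))),
      S₀.Finite ∧ (∀ j, (E j).Finite) ∧ (∀ j, Module.finrank F₀ (K j) = 2) ∧
      (∀ v ∉ S₀, {H : Subgroup (Field.absoluteGaloisGroup F₀) | ∃ j, H = (absGaloisRestrict F₀ (K j)).range ∧
          (v.asIdeal.primesOver (𝓞 (K j))).ncard = 2 ∧ v ∉ E j}.Infinite) ∧
      (∀ j, (τ' j).1.HasInfinityType (T j) ∧ (T j).IsCAlgebraic ∧ (T j).IsWeaklyRegular ∧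
          (τ' j).1.IsConjSelfDualAE (NumberField.IsCMField.complexConj (K j)) ∧
          (τ' j).1.HasAsaiSign (NumberField.IsCMField.complexConj (K j)) 1 ∧ (ψ₁ j).IsAlgebraic) ∧
      (∀ (v : HeightOneSpectrum (𝓞 F₀)) (α : HeightOneSpectrum (𝓞 F) → Multiset ℂ)
          (c : HeightOneSpectrum (𝓞 F) → ℂ), ((ℓ : ℕ) : 𝓞 F₀) ∉ v.asIdeal →
        (∀ w : HeightOneSpectrum (𝓞 F), w.under (𝓞 F₀) = v → w.asIdeal.ramificationIdx (𝓞 F₀) = 1 ∧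
            π.1.HasSatakeParamAt w (α w) ∧ eψ.IsUnramifiedAt w ∧
            eψ.HasFrobCharpolyAt w (Polynomial.X - Polynomial.C (c w))) →
        (∀ j, v ∉ E j → (v.asIdeal.primesOver (𝓞 (K j))).ncard = 2 →
            ∀ u : HeightOneSpectrum (𝓞 (K j)), u.under (𝓞 F₀) = v →
              ((ℓ : ℕ) : 𝓞 (K j)) ∉ u.asIdeal ∧ (ψ₁ j).IsUnramifiedAt u ∧
            ∃ β : Multiset ℂ, (τ' j).1.HasSatakeParamAt u β ∧
              arithFrobPolyOfSatake ι u.residueCard (2 * n)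
                  (β.map (fun b ↦ b * ((ψ₁ j).valueAtUniformizer u)⁻¹)) =
                (∏ᶠ w ∈ {w : HeightOneSpectrum (𝓞 F) | w.under (𝓞 F₀) = v},
              Polynomial.expand (PadicAlgCl ℓ) (w.asIdeal.inertiaDeg (𝓞 F₀))
                (arithFrobPolyOfSatake ι w.residueCard n ((α w).map (fun a ↦ a * c w))))) ∧
        (∃ j, (v.asIdeal.primesOver (𝓞 (K j))).ncard = 2 ∧
            ∃ u : HeightOneSpectrum (𝓞 (K j)), u.under (𝓞 F₀) = v ∧
              ((ℓ : ℕ) : 𝓞 (K j)) ∉ u.asIdeal ∧ (ψ₁ j).IsUnramifiedAt u ∧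
            ∃ β : Multiset ℂ, (τ' j).1.HasSatakeParamAt u β ∧
              arithFrobPolyOfSatake ι u.residueCard (2 * n)
                  (β.map (fun b ↦ b * ((ψ₁ j).valueAtUniformizer u)⁻¹)) =
                (∏ᶠ w ∈ {w : HeightOneSpectrum (𝓞 F) | w.under (𝓞 F₀) = v},
              Polynomial.expand (PadicAlgCl ℓ) (w.asIdeal.inertiaDeg (𝓞 F₀))
                (arithFrobPolyOfSatake ι w.residueCard n ((α w).map (fun a ↦ a * c w)))))) := by
  sorry

/-! ## Stub 5 — Galois representations over the CM field (SMO + Fakhruddin–Pilloni + Weil + untwist) -/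

/-- **Stub 5 (`stub_galoisOverK`).**  For a CM field `K`, a cuspidal `P` on `GL_N(𝔸_K)` with a
`C`-algebraic weakly regular infinity type, conjugate self-dual (a.e. on Satake parameters) and ODD
(standard Asai sign), and an ALGEBRAIC Hecke character `ψ` of `K`: for every `ℓ`, `ι` there is a
continuous SEMISIMPLE `r : Γ_K → GL_N(ℚ̄_ℓ)` which at every finite `u ∤ ℓ` where `P` has Satake
parameter `β` and `ψ` is unramified is unramified with arithmetic-Frobenius characteristic polynomial
that of the `ψ(ϖ_u)⁻¹`-twisted parameter, `arithFrobPolyOfSatake ι q_u N (β · ψ(ϖ_u)⁻¹)`.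
Intended proof: a.e. conjugate self-duality ⇒ the pairing form `IsEssConjSelfDual 1` (strong
multiplicity one, Jacquet–Shalika 1981, with the contragredient datum); `r₀` := Fakhruddin–Pilloni
Thm 9.10 (tree fact `FakhruddinPilloni2021_galoisRep_of_weaklyRegular_odd`: unramified with polynomial
`arithFrobPolyOfSatake ι q_u N β` at EVERY unramified `u ∤ ℓ`); `χ̃` := Weil's `ℓ`-adic character of `ψ`
(PROVED: `HeckeCharacter.IsAlgebraic.exists_lAdic`, polynomial `X - C (ι⁻¹(ψ(ϖ_u))⁻¹)`);
`r₁ := r₀ ⊗ χ̃⁻¹` (`FramedRep.twist`; eigenvalues multiply by `ι⁻¹(ψ(ϖ_u))`, and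
`ι⁻¹((√q)^{N-1} b ψ(ϖ)⁻¹)⁻¹ = ι⁻¹((√q)^{N-1} b)⁻¹ · ι⁻¹(ψ(ϖ))`); `r` := a CONTINUOUS semisimplification of
`r₁` (same characteristic polynomials, kernel containment ⇒ unramified where `r₁` is; every-rank
construction landed for crux `IrreducibleGL3CM`, `…ContinuousSemisimplification`).
[cite: FakhruddinPilloni2021, Thm 9.10] [cite: JacquetShalikaAJM1981] (Weil 1956 / Serre 1968: tree) -/
theorem stub_galoisOverK :
    ∀ (N : ℕ) (K : Type) [Field K] [NumberField K] [IsCMField K]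
      (hcpt : isCompact_glFiniteIntegralLevel N K) (P : CuspidalAutomorphicRepData N K hcpt)
      (T : InfinityType K N) (ψ : HeckeCharacter K),
      P.1.HasInfinityType T → T.IsCAlgebraic → T.IsWeaklyRegular →
      P.1.IsConjSelfDualAE (NumberField.IsCMField.complexConj K) →
      P.1.HasAsaiSign (NumberField.IsCMField.complexConj K) 1 → ψ.IsAlgebraic →
    ∀ (ℓ : ℕ) [Fact ℓ.Prime] (ι : PadicAlgCl ℓ ≃+* ℂ),
      ∃ r : FramedGaloisRep K (PadicAlgCl ℓ) N, r.toGaloisRep.IsSemisimple ∧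
        ∀ (u : HeightOneSpectrum (𝓞 K)) (β : Multiset ℂ), ((ℓ : ℕ) : 𝓞 K) ∉ u.asIdeal →
          P.1.HasSatakeParamAt u β → ψ.IsUnramifiedAt u →
            r.IsUnramifiedAt u ∧
              r.HasFrobCharpolyAt u
                (arithFrobPolyOfSatake ι u.residueCard N (β.map (fun b ↦ b * (ψ.valueAtUniformizer u)⁻¹))) := by
  sorry

/-! ## Stub 6 — patching the CM-field representations down to `F₀` and reading off every good place -/

/-- **Stub 6 (`stub_patch`, the Galois assembly).**  Pure Galois theory over the base: given a family of
quadratic extensions `K_j/F₀` with continuous semisimple `r_j : Γ_{K_j} → GL_{2n}(ℚ̄_ℓ)`, finite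
exceptional sets `E_j` and a finite `S₀` such that (generality) every `v ∉ S₀` splits in infinitely
many Galois-theoretically distinct members with `v ∉ E_j`, (control) for every member, every good
`v ∉ E_j` split in `K_j` and every `u ∣ v`, `r_j` is unramified at `u` with arithmetic-Frobenius
polynomial the host polynomial `∏_{w∣v} P_w(X^{f(w∣v)})` of the guard family, and (coverage) every good
`v ∤ ℓ` splits in some member with that control at ONE `u ∣ v` — there is a continuous semisimple
`R : Γ_{F₀} → GL_{2n}(ℚ̄_ℓ)`, unramified with the host polynomial at EVERY good `v`.
Intended proof: Sorensen's patching lemma, PROVED in the tree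
(`SorensenPatching.exists_framedGaloisRep`: `[K_j : F₀] = 2` prime, Galois), whose hypotheses (a)
`r_j^σ ≃ r_j` and (b) `r_j|_{Γ_{K_jK_{j'}}} ≃ r_{j'}|` follow from the control clause: the places of `K_j`
over good split `v ∉ E_j` have density one (good places are cofinite: Flath
`hasSatakeParamAt_cofinite_holds`, `eψ` continuous of finite image unramified a.e. with Frobenius
polynomials, finitely many ramified `v`), both sides are semisimple with equal characteristic
polynomials there (`u` and `ū` get the same host polynomial), so Chebotarev
(`absoluteGaloisGroup.frobenius_dense`, `chebotarev_artinRep_holds`) + continuity + Brauer–Nesbitt in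
characteristic `0` give the equivalences; then `R|_{Γ_{K_j}} ≃ r_j`, and at a good `v` coverage gives a
member with `v` split and one controlled `u ∣ v`: the decomposition groups above `v` lie in `Γ_{K_j}`
(`decompositionSubgroup_le_range_of_ncard_primesOver_eq`) and are `Γ_{F₀}`-conjugate, so `R` is
unramified at `v` and every arithmetic Frobenius above `v` is conjugate to one above `u`
(`f(u∣v) = 1`), with the host polynomial.
[cite: Sorensen2020, Lemma 2] [cite: HarrisLanTaylorThorneRMS2016, proof of Cor 7.14] -/
theorem stub_patch :
    ∀ (F₀ F : Type) [Field F₀] [NumberField F₀] [Field F] [NumberField F] [Algebra F₀ F]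
      (n : ℕ) (hcpt : isCompact_glFiniteIntegralLevel n F) (π : CuspidalAutomorphicRepData n F hcpt)
      (ℓ : ℕ) [Fact ℓ.Prime] (ι : PadicAlgCl ℓ ≃+* ℂ) (eψ : FramedGaloisRep F ℂ 1),
    (∃ (J : Type) (K : J → Type) (_ : ∀ j, Field (K j)) (_ : ∀ j, NumberField (K j))
        (_ : ∀ j, Algebra F₀ (K j)) (r : ∀ j, FramedGaloisRep (K j) (PadicAlgCl ℓ) (2 * n))
        (E : J → Set (HeightOneSpectrum (𝓞 F₀))) (S₀ : Set (HeightOneSpectrum (𝓞 F₀))),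
        S₀.Finite ∧ (∀ j, (E j).Finite) ∧ (∀ j, Module.finrank F₀ (K j) = 2) ∧
        (∀ j, (r j).toGaloisRep.IsSemisimple) ∧
        (∀ v ∉ S₀, {H : Subgroup (Field.absoluteGaloisGroup F₀) | ∃ j, H = (absGaloisRestrict F₀ (K j)).range ∧
          (v.asIdeal.primesOver (𝓞 (K j))).ncard = 2 ∧ v ∉ E j}.Infinite) ∧
        (∀ (v : HeightOneSpectrum (𝓞 F₀)) (α : HeightOneSpectrum (𝓞 F) → Multiset ℂ)
          (c : HeightOneSpectrum (𝓞 F) → ℂ), ((ℓ : ℕ) : 𝓞 F₀) ∉ v.asIdeal →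
        (∀ w : HeightOneSpectrum (𝓞 F), w.under (𝓞 F₀) = v → w.asIdeal.ramificationIdx (𝓞 F₀) = 1 ∧
            π.1.HasSatakeParamAt w (α w) ∧ eψ.IsUnramifiedAt w ∧
            eψ.HasFrobCharpolyAt w (Polynomial.X - Polynomial.C (c w))) →
        (∀ j, v ∉ E j → (v.asIdeal.primesOver (𝓞 (K j))).ncard = 2 →
            ∀ u : HeightOneSpectrum (𝓞 (K j)), u.under (𝓞 F₀) = v →
              (r j).IsUnramifiedAt u ∧ (r j).HasFrobCharpolyAt u
              (∏ᶠ w ∈ {w : HeightOneSpectrum (𝓞 F) | w.under (𝓞 F₀) = v},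
              Polynomial.expand (PadicAlgCl ℓ) (w.asIdeal.inertiaDeg (𝓞 F₀))
                (arithFrobPolyOfSatake ι w.residueCard n ((α w).map (fun a ↦ a * c w))))) ∧
        (∃ j, (v.asIdeal.primesOver (𝓞 (K j))).ncard = 2 ∧
            ∃ u : HeightOneSpectrum (𝓞 (K j)), u.under (𝓞 F₀) = v ∧
              (r j).IsUnramifiedAt u ∧ (r j).HasFrobCharpolyAt u
              (∏ᶠ w ∈ {w : HeightOneSpectrum (𝓞 F) | w.under (𝓞 F₀) = v},
              Polynomial.expand (PadicAlgCl ℓ) (w.asIdeal.inertiaDeg (𝓞 F₀))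
                (arithFrobPolyOfSatake ι w.residueCard n ((α w).map (fun a ↦ a * c w))))))) →
    ∃ R : FramedGaloisRep F₀ (PadicAlgCl ℓ) (2 * n), R.toGaloisRep.IsSemisimple ∧
      ∀ (v : HeightOneSpectrum (𝓞 F₀)) (α : HeightOneSpectrum (𝓞 F) → Multiset ℂ)
          (c : HeightOneSpectrum (𝓞 F) → ℂ), ((ℓ : ℕ) : 𝓞 F₀) ∉ v.asIdeal →
        (∀ w : HeightOneSpectrum (𝓞 F), w.under (𝓞 F₀) = v → w.asIdeal.ramificationIdx (𝓞 F₀) = 1 ∧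
            π.1.HasSatakeParamAt w (α w) ∧ eψ.IsUnramifiedAt w ∧
            eψ.HasFrobCharpolyAt w (Polynomial.X - Polynomial.C (c w))) →
        R.IsUnramifiedAt v ∧ R.HasFrobCharpolyAt v
          (∏ᶠ w ∈ {w : HeightOneSpectrum (𝓞 F) | w.under (𝓞 F₀) = v},
              Polynomial.expand (PadicAlgCl ℓ) (w.asIdeal.inertiaDeg (𝓞 F₀))
                (arithFrobPolyOfSatake ι w.residueCard n ((α w).map (fun a ↦ a * c w)))) := by
  sorry

/-! ## Stub 7 — the complementary known stratum: `F` totally real (Harris–Lan–Taylor–Thorne + induction) -/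

/-- **Stub 7 (`stub_totallyRealInduction`).**  For `F` TOTALLY REAL, quadratic over `F₀`, EVERY cuspidal
regular algebraic `π` on `GL_n(𝔸_F)` and EVERY rank-one Artin representation `eψ` of `Γ_F`: the induced
package exists — a continuous semisimple `R : Γ_{F₀} → GL_{2n}(ℚ̄_ℓ)`, unramified with the host
polynomial `∏_{w∣v} P_w(X^{f(w∣v)})` at every good `v ∤ ℓ` (no polarization, parity or non-invariance
hypothesis: this is the known case, much stronger than the crux's totally real stratum, and it is the
stratum the pane cannot see — for `n = 1` and weight-one induced forms the unitary engine provably has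
no type-I standard normalisation).
Intended proof (= Disproof gen-4 §9 `hostConclusion_of_reciprocity_of_induction` with its two inputs):
`TwistedStrongReciprocityAt π eψ ℓ ι` from lang.S27 (`exists_galoisRep_of_regularAlgebraic`,
Harris–Lan–Taylor–Thorne Thm A: semisimple `ρ`, `arithFrobPolyOfSatake ι q_w n α` at every unramified
`w ∤ ℓ`) twisted by `(eψ.lAdicAvatar ι)⁻¹` (`hasFrobCharpolyAt_lAdicAvatar`: `X - C (ι⁻¹ c_w)`; eigenvalues
`ι⁻¹((√q_w)^{n-1} a c_w)⁻¹` = the roots of `P_w`; Disproof §12 does exactly this twist in rank one), and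
`HasQuadraticInduction F₀ F ℓ n` (Disproof §9; rank one PROVED in §11 `hasQuadraticInduction_one` from
`FramedGaloisRep.induce`, Ash's `exists_charpoly_induce_eq_prod`, `isUnramifiedAt_induce`, continuous
semisimplification): at a good `v` the induced Frobenius polynomial is `P_w·P_{τw}` (split) or `P_w(X²)`
(inert) — §4 `charpoly_fromBlocks_zero_one`, §3b `hostPoly_of_smul_eq/ne`.
[cite: HarrisLanTaylorThorneRMS2016, Thm A] (lang.S27; induction: Serre, Linear representations §7) -/
theorem stub_totallyRealInduction :
    ∀ (F₀ F : Type) [Field F₀] [NumberField F₀] [Field F] [NumberField F] [Algebra F₀ F]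
      (n : ℕ) (hcpt : isCompact_glFiniteIntegralLevel n F) (π : CuspidalAutomorphicRepData n F hcpt)
      (ℓ : ℕ) [Fact ℓ.Prime] (ι : PadicAlgCl ℓ ≃+* ℂ) (eψ : FramedGaloisRep F ℂ 1),
      NumberField.IsTotallyReal F → Module.finrank F₀ F = 2 → π.1.IsRegularAlgebraic →
    ∃ R : FramedGaloisRep F₀ (PadicAlgCl ℓ) (2 * n), R.toGaloisRep.IsSemisimple ∧
      ∀ (v : HeightOneSpectrum (𝓞 F₀)) (α : HeightOneSpectrum (𝓞 F) → Multiset ℂ)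
          (c : HeightOneSpectrum (𝓞 F) → ℂ), ((ℓ : ℕ) : 𝓞 F₀) ∉ v.asIdeal →
        (∀ w : HeightOneSpectrum (𝓞 F), w.under (𝓞 F₀) = v → w.asIdeal.ramificationIdx (𝓞 F₀) = 1 ∧
            π.1.HasSatakeParamAt w (α w) ∧ eψ.IsUnramifiedAt w ∧
            eψ.HasFrobCharpolyAt w (Polynomial.X - Polynomial.C (c w))) →
        R.IsUnramifiedAt v ∧ R.HasFrobCharpolyAt v
          (∏ᶠ w ∈ {w : HeightOneSpectrum (𝓞 F) | w.under (𝓞 F₀) = v},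
              Polynomial.expand (PadicAlgCl ℓ) (w.asIdeal.inertiaDeg (𝓞 F₀))
                (arithFrobPolyOfSatake ι w.residueCard n ((α w).map (fun a ↦ a * c w)))) := by
  sorry

/-! ## The composition -/

/-- **`HostInducedRep_of` — the kernel-checked composition of the seven stubs into the crux, by name.**
If `F` is totally real, `stub_totallyRealInduction` (the known stratum).  Otherwise
`stub_paneLaw stub_signPin stub_asaiPoleInduced` is the pane law; `stub_package` turns the crux data into
the CM family of type-I standard-sign packages; `stub_galoisOverK` attaches a semisimple `ℓ`-adic
representation to each member, whose Frobenius polynomials at the places over the good split places are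
rewritten into the host polynomial along the Satake clauses (control and coverage); `stub_patch`
descends the family to `F₀`.  No mathematics beyond this threading happens here. -/
theorem HostInducedRep_of : Summit.Langlands.Langlands.Theses.QuadraticWindow.HostInducedRep := by
  intro F₀ F _ _ _ _ _ τ hTR hdeg hτ n hcpt π e k hreg hpol hpar hodd ℓ _ ι hℓ hunr eψ hψunr hψpar hψnti
  by_cases hF : NumberField.IsTotallyReal F
  · exact stub_totallyRealInduction F₀ F n hcpt π ℓ ι eψ hF hdeg hreg
  have hpane := stub_paneLaw stub_signPin stub_asaiPoleInduced
  obtain ⟨J, K, iF, iNF, iCM, iA, hK, τ', T, ψ₁, E, S₀, hS₀, hE, hdegK, hgen, hFP, hplaces⟩ :=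
    stub_package hpane F₀ F τ hTR hdeg hτ n hcpt π e k hreg hpol hpar ℓ ι eψ hψpar hψnti hF
  have hr : ∀ j, ∃ r : FramedGaloisRep (K j) (PadicAlgCl ℓ) (2 * n), r.toGaloisRep.IsSemisimple ∧
      ∀ (u : HeightOneSpectrum (𝓞 (K j))) (β : Multiset ℂ), ((ℓ : ℕ) : 𝓞 (K j)) ∉ u.asIdeal →
        (τ' j).1.HasSatakeParamAt u β → (ψ₁ j).IsUnramifiedAt u →
          r.IsUnramifiedAt u ∧
            r.HasFrobCharpolyAt u (arithFrobPolyOfSatake ι u.residueCard (2 * n)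
              (β.map (fun b ↦ b * ((ψ₁ j).valueAtUniformizer u)⁻¹))) := fun j =>
    stub_galoisOverK (2 * n) (K j) (hK j) (τ' j) (T j) (ψ₁ j) (hFP j).1 (hFP j).2.1 (hFP j).2.2.1
      (hFP j).2.2.2.1 (hFP j).2.2.2.2.1 (hFP j).2.2.2.2.2 ℓ ι
  choose r hrss hrloc using hr
  refine stub_patch F₀ F n hcpt π ℓ ι eψ ⟨J, K, iF, iNF, iA, r, E, S₀, hS₀, hE, hdegK, hrss, hgen, ?_⟩
  intro v α c hv hguard
  obtain ⟨hall, j, hsplit, u, hu, hℓu, hψu, β, hβ, hEq⟩ := hplaces v α c hv hguard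
  refine ⟨fun j' hvE hsplit' u' hu' => ?_, ?_⟩
  · obtain ⟨hℓu', hψu', β', hβ', hEq'⟩ := hall j' hvE hsplit' u' hu'
    have h := hrloc j' u' β' hℓu' hβ' hψu'
    exact ⟨h.1, hEq' ▸ h.2⟩
  · have h := hrloc j u β hℓu hβ hψu
    exact ⟨j, hsplit, u, hu, h.1, hEq ▸ h.2⟩

end Summit.Langlands.Langlands.Cruxes.HostInducedRep.OneTransparentPane
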